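import Literature.Geometry.Lorentzian.CoordRicciEigenframe
import Literature.Geometry.Lorentzian.CoordOrthonormalEigenframe
import HarnessLib

/-!
# `Ric ≥ 0` from `2 Ric ≤ S g` in dimension three

The last step of the elliptic Hamilton–Ivey estimate (`sect ≥ 0 ⇒ Ric ≥ 0`) in the coordinate
language of `CoordCurvature.lean`: for metric components `G` on a `3`-dimensional model space `E`,
positive definite at `x`, the pinching `2 Ric_x(w,w) ≤ S(x) G_x(w,w)` for all `w` forces
`Ric_x ≥ 0` (`ricAt_nonneg_of_two_mul_le_scalAt`). In a `G_x`-orthonormal eigenframe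
`(e₀, e₁, e₂)` of `Ric_x` with eigenvalues `μᵢ` (`exists_orthonormal_eigenframe`) one has
`S = μ₀ + μ₁ + μ₂` (`scalAt_eq_sum_of_eigenframe`), and the hypothesis on `eᵢ` reads `2μᵢ ≤ S`,
i.e. the sectional curvatures `K_{jk} = S/2 − μᵢ` (`{i,j,k} = {0,1,2}`) are nonnegative — in
dimension three the Ricci form determines the sectional curvatures, `Ric(eᵢ,eᵢ) = Σ_{j≠i} K_{ij}`
(Lee 2018, Prop. 8.32). Hence `μᵢ = K_{ij} + K_{ik} ≥ 0` and
`Ric(w,w) = Σᵢ μᵢ G(w,eᵢ)² ≥ 0`.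

The same expansion gives, in any dimension, the bound of the Ricci form by its top eigenvalue
(`ricAt_le_of_eigenframe_le`): if `Ric_x(eᵢ, ·) = μᵢ G_x(eᵢ, ·)` in a `G_x`-orthonormal basis and
`μᵢ ≤ c` for all `i`, then `Ric_x(w,w) = Σᵢ μᵢ G(w,eᵢ)² ≤ c Σᵢ G(w,eᵢ)² = c G_x(w,w)` — the
inequality `λ_max ≤ maxᵢ μᵢ` between the top Rayleigh quotient `λ_max = sup_{w ≠ 0} Ric(w,w)/G(w,w)`
(`CoordRayleighSup.lean`) and the top eigenvalue of an eigenframe. The mirror statement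
`mul_le_ricAt_of_le_eigenframe` (`c ≤ μᵢ` for all `i` gives `c G_x(w,w) ≤ Ric_x(w,w)`) is the
inequality `minᵢ μᵢ ≤ λ_min = inf_{w ≠ 0} Ric(w,w)/G(w,w)` for the bottom eigenvalue.

Everything is proved; no definitions are introduced.

## References

* J. M. Lee, *Introduction to Riemannian Manifolds*, 2nd ed. (2018), Prop. 8.32. [Lee2018]
* B. O'Neill, *Semi-Riemannian geometry*, 1983, Ch. 3, Lemma 3.52, Def. 3.53. [ONeill1983]
-/

noncomputable section

set_option maxSynthPendingDepth 3

open Module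

namespace Literature.Geometry.Lorentzian

namespace MetricCoord

variable {E : Type*} [NormedAddCommGroup E] [NormedSpace ℝ E] [FiniteDimensional ℝ E]

/-- **`Ric ≥ 0` from `2 Ric ≤ S g` in dimension three.** For metric components `G` on `V`,
positive definite at `x ∈ V`, with `finrank ℝ E = 3`: if `2 Ric_x(w,w) ≤ S(x) G_x(w,w)` for every
`w`, then `Ric_x(w,w) ≥ 0` for every `w`. In an orthonormal eigenframe of `Ric_x` with eigenvalues
`μ₀, μ₁, μ₂` the hypothesis says `2μᵢ ≤ S = μ₀ + μ₁ + μ₂`, i.e. all sectional curvatures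
`S/2 − μᵢ` are `≥ 0` (Lee 2018, Prop. 8.32: `Ric(eᵢ,eᵢ) = Σ_{j≠i} K_{ij}` in dimension `3`), so
each `μᵢ ≥ 0` and `Ric(w,w) = Σ μᵢ G(w,eᵢ)² ≥ 0`. [cite: Lee2018, Prop. 8.32] -/
theorem ricAt_nonneg_of_two_mul_le_scalAt [CompleteSpace E] {G : E → E →L[ℝ] E →L[ℝ] ℝ}
    {V : Set E} {x : E} (hG : IsMetricOn G V) (hx : x ∈ V) (h3 : Module.finrank ℝ E = 3)
    (hpos : ∀ w : E, w ≠ 0 → 0 < G x w w)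
    (hle : ∀ w : E, 2 * ricAt G x w w ≤ scalAt G x * G x w w) (w : E) : 0 ≤ ricAt G x w w := by
  classical
  have hs := hG.symm x hx
  have hi := hG.isInvertible x hx
  -- an orthonormal eigenframe of `Ric_x`, reindexed by `Fin 3`
  obtain ⟨e', μ', he', hμ'⟩ := exists_orthonormal_eigenframe hs hpos (ricAt G x)
    (fun v w ↦ hG.ricAt_comm hx v w)
  set e : Basis (Fin 3) ℝ E := e'.reindex (finCongr h3) with hedef
  set μ : Fin 3 → ℝ := μ' ∘ (finCongr h3).symm with hμdef
  have he : ∀ i j, G x (e i) (e j) = if i = j then 1 else 0 := fun i j ↦ by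
    rw [hedef, Basis.reindex_apply, Basis.reindex_apply, he']
    simp only [finCongr_symm, finCongr_apply, Fin.cast_inj]
  have hμ : ∀ i w, ricAt G x (e i) w = μ i * G x (e i) w := fun i w ↦ by
    rw [hedef, Basis.reindex_apply, hμ', hμdef, Function.comp_apply]
  -- `S = μ₀ + μ₁ + μ₂` and `2 μᵢ ≤ S` (the hypothesis on `eᵢ`), hence `μᵢ ≥ 0`
  have hS : scalAt G x = μ 0 + μ 1 + μ 2 := by
    rw [scalAt_eq_sum_of_eigenframe e he hμ hi, Fin.sum_univ_three]
  have hμle : ∀ i, 2 * μ i ≤ μ 0 + μ 1 + μ 2 := fun i ↦ by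
    have h := hle (e i)
    rw [ricAt_eigenframe_apply e he hμ, he, if_pos rfl, if_pos rfl, mul_one, hS] at h
    exact h
  have n0 : 0 ≤ μ 0 := by linarith [hμle 1, hμle 2]
  have n1 : 0 ≤ μ 1 := by linarith [hμle 0, hμle 2]
  have n2 : 0 ≤ μ 2 := by linarith [hμle 0, hμle 1]
  -- `Ric(w,w) = Σ μᵢ G(w,eᵢ)²`, a sum of nonnegative terms
  have hexp : ricAt G x w w = ∑ i, μ i * (G x w (e i) * G x w (e i)) := by
    have h := sum_apply_smul_of_orthonormal e he w
    calc ricAt G x w w = ricAt G x (∑ i, G x w (e i) • e i) w := by rw [h]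
      _ = ∑ i, G x w (e i) * ricAt G x (e i) w := by
          simp only [map_sum, map_smul, FunLike.coe_sum, Finset.sum_apply, FunLike.coe_smul,
            Pi.smul_apply, smul_eq_mul]
      _ = ∑ i, μ i * (G x w (e i) * G x w (e i)) := by
          refine Finset.sum_congr rfl fun i _ ↦ ?_
          rw [hμ, hs (e i) w]
          ring
  rw [hexp, Fin.sum_univ_three]
  exact add_nonneg (add_nonneg (mul_nonneg n0 (mul_self_nonneg _))
    (mul_nonneg n1 (mul_self_nonneg _))) (mul_nonneg n2 (mul_self_nonneg _))

/-- **The top eigenvalue bounds the Ricci form.** In a `G_x`-orthonormal basis `e` diagonalising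
the (symmetric) Ricci form, `Ric_x(eᵢ, ·) = μᵢ G_x(eᵢ, ·)`, if every eigenvalue satisfies `μᵢ ≤ c`
then `Ric_x(w,w) ≤ c G_x(w,w)` for every `w`: writing `w = Σᵢ G(w,eᵢ) eᵢ` one has
`Ric(w,w) = Σᵢ μᵢ G(w,eᵢ)² ≤ c Σᵢ G(w,eᵢ)² = c G(w,w)` (the Rayleigh quotient of a symmetric form is
at most its largest eigenvalue). No positivity or symmetry of `G_x` beyond the orthonormality of `e`
is used. [folklore] -/
theorem ricAt_le_of_eigenframe_le {G : E → E →L[ℝ] E →L[ℝ] ℝ} {x : E}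
    {ι : Type*} [Fintype ι] [DecidableEq ι] (e : Basis ι ℝ E)
    (he : ∀ i j, G x (e i) (e j) = if i = j then 1 else 0)
    {μ : ι → ℝ} (hμ : ∀ i w, ricAt G x (e i) w = μ i * G x (e i) w)
    (hs : ∀ v w, ricAt G x v w = ricAt G x w v) {c : ℝ} (hc : ∀ i, μ i ≤ c) (w : E) :
    ricAt G x w w ≤ c * G x w w := by
  have h := sum_apply_smul_of_orthonormal e he w
  -- `G(eᵢ, w) = G(w, eᵢ)`, by orthonormality (expand `w` in the second slot)
  have hflip : ∀ i, G x (e i) w = G x w (e i) := fun i ↦ by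
    conv_lhs => rw [← h]
    simp only [map_sum, map_smul, smul_eq_mul, he, mul_ite, mul_one, mul_zero,
      Finset.sum_ite_eq, Finset.mem_univ, if_true]
  -- `Ric(w,w) = Σ μᵢ G(w,eᵢ)²` and `G(w,w) = Σ G(w,eᵢ)²`
  have hRic : ricAt G x w w = ∑ i, μ i * (G x w (e i) * G x w (e i)) := by
    calc ricAt G x w w = ricAt G x w (∑ i, G x w (e i) • e i) := by rw [h]
      _ = ∑ i, G x w (e i) * ricAt G x w (e i) := by simp only [map_sum, map_smul, smul_eq_mul]
      _ = ∑ i, μ i * (G x w (e i) * G x w (e i)) := by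
          refine Finset.sum_congr rfl fun i _ ↦ ?_
          rw [hs w (e i), hμ, hflip]
          ring
  have hG : G x w w = ∑ i, G x w (e i) * G x w (e i) := by
    calc G x w w = G x w (∑ i, G x w (e i) • e i) := by rw [h]
      _ = ∑ i, G x w (e i) * G x w (e i) := by simp only [map_sum, map_smul, smul_eq_mul]
  rw [hRic, hG, Finset.mul_sum]
  exact Finset.sum_le_sum fun i _ ↦ mul_le_mul_of_nonneg_right (hc i) (mul_self_nonneg _)

/-- **The bottom eigenvalue bounds the Ricci form from below.** In a `G_x`-orthonormal basis `e`
diagonalising the (symmetric) Ricci form, `Ric_x(eᵢ, ·) = μᵢ G_x(eᵢ, ·)`, if every eigenvalue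
satisfies `c ≤ μᵢ` then `c G_x(w,w) ≤ Ric_x(w,w)` for every `w`: writing `w = Σᵢ G(w,eᵢ) eᵢ` one
has `c G(w,w) = c Σᵢ G(w,eᵢ)² ≤ Σᵢ μᵢ G(w,eᵢ)² = Ric(w,w)` (the Rayleigh quotient of a symmetric
form is at least its smallest eigenvalue; the mirror image of `ricAt_le_of_eigenframe_le`, giving
`minᵢ μᵢ ≤ λ_min = inf_{w ≠ 0} Ric(w,w)/G(w,w)`). No positivity or symmetry of `G_x` beyond the
orthonormality of `e` is used. [folklore] -/
theorem mul_le_ricAt_of_le_eigenframe {G : E → E →L[ℝ] E →L[ℝ] ℝ} {x : E}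
    {ι : Type*} [Fintype ι] [DecidableEq ι] (e : Basis ι ℝ E)
    (he : ∀ i j, G x (e i) (e j) = if i = j then 1 else 0)
    {μ : ι → ℝ} (hμ : ∀ i w, ricAt G x (e i) w = μ i * G x (e i) w)
    (hs : ∀ v w, ricAt G x v w = ricAt G x w v) {c : ℝ} (hc : ∀ i, c ≤ μ i) (w : E) :
    c * G x w w ≤ ricAt G x w w := by
  have h := sum_apply_smul_of_orthonormal e he w
  -- `G(eᵢ, w) = G(w, eᵢ)`, by orthonormality (expand `w` in the second slot)
  have hflip : ∀ i, G x (e i) w = G x w (e i) := fun i ↦ by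
    conv_lhs => rw [← h]
    simp only [map_sum, map_smul, smul_eq_mul, he, mul_ite, mul_one, mul_zero,
      Finset.sum_ite_eq, Finset.mem_univ, if_true]
  -- `Ric(w,w) = Σ μᵢ G(w,eᵢ)²` and `G(w,w) = Σ G(w,eᵢ)²`
  have hRic : ricAt G x w w = ∑ i, μ i * (G x w (e i) * G x w (e i)) := by
    calc ricAt G x w w = ricAt G x w (∑ i, G x w (e i) • e i) := by rw [h]
      _ = ∑ i, G x w (e i) * ricAt G x w (e i) := by simp only [map_sum, map_smul, smul_eq_mul]
      _ = ∑ i, μ i * (G x w (e i) * G x w (e i)) := by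
          refine Finset.sum_congr rfl fun i _ ↦ ?_
          rw [hs w (e i), hμ, hflip]
          ring
  have hG : G x w w = ∑ i, G x w (e i) * G x w (e i) := by
    calc G x w w = G x w (∑ i, G x w (e i) • e i) := by rw [h]
      _ = ∑ i, G x w (e i) * G x w (e i) := by simp only [map_sum, map_smul, smul_eq_mul]
  rw [hRic, hG, Finset.mul_sum]
  exact Finset.sum_le_sum fun i _ ↦ mul_le_mul_of_nonneg_right (hc i) (mul_self_nonneg _)

end MetricCoord

end Literature.Geometry.Lorentzian

end
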